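import Literature.MathematicalPhysics.QuantumLattice.BargmannHallWightmanConnected
import Literature.MathematicalPhysics.QuantumLattice.ComplexLorentzGroupConnected
import HarnessLib

/-!
# The Bargmann–Hall–Wightman theorem: discharge

Topic `Literature/MathematicalPhysics/QuantumLattice` (trunk T-AQFT). This file **discharges** the
named facts `oneTubeMeetSet_isConnected` (`BargmannHallWightmanConnected`: the set
`N₁ = {g ∈ L₊(ℂ) | gI₁ ∩ I₁ ≠ ∅}` is connected, Qiao (2022) §6.2.2 / Jost (1965)) and hence
`exists_extension_extendedForwardTube` (`SchwingerWightman`: the Bargmann–Hall–Wightman theorem,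
Streater–Wightman Thm. 2-11, invariant case) in every space dimension `d` and for every number of
points `n`:

* `oneTubeMeetSet_isConnected_holds (d : ℕ) : oneTubeMeetSet_isConnected d`;
* `exists_extension_extendedForwardTube_holds : exists_extension_extendedForwardTube (d := d) (n := n)`;
* `IsWightmanQFT.exists_invariant_continuation_of_spectral_of_laplace`: the `L₊(ℂ)`-invariant
  continuation of the Wightman functions (`IsWightmanQFT.exists_invariant_continuation`, S–W
  Thm. 3-5 with Thm. 2-11) now rests only on the spectral condition of the Wightman distributions
  (S–W Thm. 3-2 (b)) and the Fourier–Laplace representation (Hörmander Thm. 7.4.2).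

## The proof that `N₁` is path connected

`N₁` consists of the proper complex Lorentz matrices `Λ` admitting `ζ` with `Im ζ ∈ V₊` and
`Im Λζ ∈ V₊`; we join every `Λ ∈ N₁` to `1` inside `N₁`.

1. *The Cayley segment* (`BHW.joinedIn_oneTubeMeetSet_of_det_ne_zero`). If `1 + Λ` is invertible,
   `Λ = C(X)` with `X = C(Λ)` `η`-skew, and with `ξ = ½(1 + Λ)ζ` one has `(1 + X)ξ = ζ`,
   `(1 − X)ξ = Λζ`. For complex `t` put `ζ_t = (1 + tX)ξ`; then `C(tX)ζ_t = (1 − tX)ξ` and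
   `Im (1 ± tX)ξ = y ± (Re t · v + Im t · r)` (`y = Im ξ`, `v = Im Xξ`, `r = Re Xξ`). Since
   `y ± v ∈ V₊`, openness and convexity of `V₊` give `y ± (σv + w) ∈ V₊` for `σ ∈ [0, 1]` and small
   `w` (`BHW.exists_delta_forwardCone`): the *same* `ξ` witnesses `C(tX) ∈ N₁` for all `t` near the
   real segment `[0, 1]`. The finitely many `t` with `det (1 + tX) = 0` (roots of the polynomial
   `BHW.detPoly X`) are avoided by the arc `t(s) = s + iεs(1 − s)` for all but finitely many `ε`
   (`BHW.Orth.exists_arc_avoid`); along it `s ↦ C(t(s)X)` is a continuous path in `N₁` from `1` to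
   `Λ`.
2. *`1 + Λ` is invertible densely on `L₊(ℂ)`* (`BHW.frequently_det_one_add_ne_zero`): the property
   "`det (1 + M) = 0` for all proper Lorentz `M` near `P`" is open, and closed along limits of proper
   Lorentz matrices (in the Cayley chart at `P` the holomorphic `B ↦ det (1 + chart P B)` would
   vanish near a point of a ball, hence on the ball — Osgood and the identity theorem, the
   determinant being differentiable by the Leibniz formula, `BHW.differentiable_det`); along the
   path from `P` to `1` in `L₊(ℂ)` (`BHW.exists_path_properLorentz`, `ComplexLorentzGroupConnected`)
   it would propagate to `1`, where `det 2 ≠ 0`.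
3. *General `Λ ∈ N₁`* (`BHW.joinedIn_oneTubeMeetSet_one`): `N₁` is open in `L₊(ℂ)`, so a chart
   ball at `Λ` lies in `N₁`; by step 2 it contains a proper Lorentz `M` with `1 + M` invertible; the
   chart segment joins `Λ` to `M` inside `N₁`, and step 1 joins `M` to `1`.

## Sources

* R. F. Streater, A. S. Wightman, *PCT, Spin and Statistics, and All That*, §2-4 and Thm. 2-11
  (pdf pp. 58–61). [StreaterWightman2001]
* J. Qiao, SciPost Phys. 13 (2022) 093, §6.2.2 (pdf p. 25). [Qiao2022]

## Mathlib / tree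

Used: `HasFDerivAt.finsetProd` (Leibniz formula `Matrix.det_apply`), `Polynomial.roots`,
`RingHom.map_det`, `JoinedIn.ofLine`, `JoinedIn.trans`, `isPathConnected_iff`,
`IsPathConnected.isConnected`; from the tree the Cayley-chart machinery of `BargmannHallWightman`
(`BHW.chart`, `BHW.unchart`, `BHW.chart_unchart`, `BHW.cayley_cayley`, …),
`QuantumFieldTheory.convex_forwardCone`, `isOpen_forwardCone`,
`Literature.Analysis.Complex.SCV.analyticOnNhd_of_differentiableOn`.
-/

noncomputable section

open Matrix

namespace Literature.MathematicalPhysics.QuantumLattice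

namespace BHW

/-! ### `det (1 + M)` does not vanish on any open subset of `L₊(ℂ)` -/

section Density

open Filter Set Metric
open _root_.Topology
open scoped Matrix.Norms.Operator

variable {d : ℕ}

/-- Entry evaluation as a continuous linear map. [folklore] -/
def entryCLM (i j : Fin (d + 1)) : Matrix (Fin (d + 1)) (Fin (d + 1)) ℂ →L[ℂ] ℂ :=
  LinearMap.toContinuousLinearMap
    { toFun := fun M => M i j
      map_add' := fun _ _ => rfl
      map_smul' := fun _ _ => rfl }

/-- `entryCLM i j M = M i j`. [folklore] -/
@[simp] theorem entryCLM_apply (i j : Fin (d + 1)) (M : Matrix (Fin (d + 1)) (Fin (d + 1)) ℂ) :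
    entryCLM i j M = M i j := rfl

/-- **The determinant is a differentiable function of the matrix** (Leibniz formula). [folklore] -/
theorem differentiable_det : Differentiable ℂ fun M : Matrix (Fin (d + 1)) (Fin (d + 1)) ℂ => M.det := by
  have h : (fun M : Matrix (Fin (d + 1)) (Fin (d + 1)) ℂ => M.det) =
      fun M => ∑ σ : Equiv.Perm (Fin (d + 1)), Equiv.Perm.sign σ • ∏ i, entryCLM (σ i) i M := by
    funext M; rw [Matrix.det_apply]; rfl
  rw [h]
  refine Differentiable.fun_sum fun σ _ => ?_
  refine Differentiable.const_smul ?_ _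
  intro M
  classical
  exact (HasFDerivAt.finsetProd (u := Finset.univ)
    (fun i _ => (entryCLM (σ i) i).hasFDerivAt)).differentiableAt

/-- `B ↦ det (1 + chart P B)` is differentiable where `1 + sk B` is invertible. [folklore] -/
theorem differentiableAt_det_one_add_chart (P : Matrix (Fin (d + 1)) (Fin (d + 1)) ℂ)
    {B : Matrix (Fin (d + 1)) (Fin (d + 1)) ℂ} (hB : IsUnit (1 + sk B).det) :
    DifferentiableAt ℂ (fun B' => (1 + chart P B').det) B :=
  (differentiable_det _).comp B ((differentiableAt_const _).add (differentiableAt_chart P hB))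

/-- `det (1 + ·)` vanishes at all proper Lorentz matrices near `P`. [folklore] -/
def DetVanishesNear (P : Matrix (Fin (d + 1)) (Fin (d + 1)) ℂ) : Prop :=
  ∀ᶠ M in 𝓝 P, IsLorentzMat M → M.det = 1 → (1 + M).det = 0

/-- The vanishing property passes to limits of proper Lorentz matrices (identity theorem in a
Cayley chart). [folklore] -/
theorem detVanishesNear_of_frequently {P : Matrix (Fin (d + 1)) (Fin (d + 1)) ℂ}
    (hP : IsLorentzMat P) (hPdet : P.det = 1)
    (hfr : ∃ᶠ Q in 𝓝 P, (IsLorentzMat Q ∧ Q.det = 1) ∧ DetVanishesNear Q) : DetVanishesNear P := by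
  -- a ball in the chart on which everything is defined
  obtain ⟨r, hr, hball⟩ := Metric.isOpen_iff.1 (isOpen_isUnit_sk (d := d)) 0
    (show (0 : Matrix (Fin (d + 1)) (Fin (d + 1)) ℂ) ∈ {B | IsUnit (1 + sk B).det} by
      simp only [mem_setOf_eq, sk_zero, add_zero, Matrix.det_one, isUnit_one])
  set f : Matrix (Fin (d + 1)) (Fin (d + 1)) ℂ → ℂ := fun B => (1 + chart P B).det with hf
  have hfd : DifferentiableOn ℂ f (ball 0 r) := fun B hB =>
    (differentiableAt_det_one_add_chart P (hball hB)).differentiableWithinAt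
  have hfa : AnalyticOnNhd ℂ f (ball 0 r) :=
    Literature.Analysis.Complex.SCV.analyticOnNhd_of_differentiableOn hfd isOpen_ball
  -- a nearby proper Lorentz matrix with the vanishing property, inside the chart
  have hev : ∀ᶠ Q in 𝓝 P, unchart P Q ∈ ball (0 : Matrix (Fin (d + 1)) (Fin (d + 1)) ℂ) r ∧
      IsUnit (1 + Q * minkInv P).det :=
    ((tendsto_unchart hP).eventually (isOpen_ball.mem_nhds (mem_ball_self hr))).and
      (eventually_isUnit_one_add hP)
  obtain ⟨Q₀, ⟨⟨hQ₀L, -⟩, hQ₀v⟩, hQ₀ball, hQ₀u⟩ := (hfr.and_eventually hev).exists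
  set B₀ := unchart P Q₀ with hB₀
  have hchart₀ : chart P B₀ = Q₀ := chart_unchart hP hQ₀L hQ₀u
  have hf0 : f =ᶠ[𝓝 B₀] 0 := by
    have hc : ContinuousAt (chart P) B₀ := (differentiableAt_chart P (hball hQ₀ball)).continuousAt
    have h1 : ∀ᶠ B in 𝓝 B₀, IsLorentzMat (chart P B) → (chart P B).det = 1 →
        (1 + chart P B).det = 0 := by
      have := hc.tendsto.eventually (show ∀ᶠ M in 𝓝 (chart P B₀), IsLorentzMat M → M.det = 1 →
        (1 + M).det = 0 by rw [hchart₀]; exact hQ₀v)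
      exact this
    have h2 : ∀ᶠ B in 𝓝 B₀, B ∈ ball (0 : Matrix (Fin (d + 1)) (Fin (d + 1)) ℂ) r :=
      isOpen_ball.mem_nhds hQ₀ball
    filter_upwards [h1, h2] with B hB hBr
    have hm := chart_mem_properLorentzMatSet (P := P) ⟨hP, hPdet⟩ (hball hBr)
    exact hB hm.1 hm.2
  have hfball : EqOn f 0 (ball 0 r) :=
    hfa.eqOn_zero_of_preconnected_of_eventuallyEq_zero (convex_ball _ _).isPreconnected hQ₀ball hf0
  -- conclude near `P`
  filter_upwards [hev] with M hM hML _
  have := hfball hM.1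
  simp only [hf, Pi.zero_apply] at this
  rwa [chart_unchart hP hML hM.2] at this

/-- **`det (1 + M)` is not identically zero near any point of `L₊(ℂ)`**: the set of proper Lorentz
matrices `M` with `1 + M` invertible is dense in `L₊(ℂ)`. Proof: the vanishing property is open and
closed along the path from `1` (where `det 2 ≠ 0`) supplied by `exists_path_properLorentz`. [folklore] -/
theorem not_detVanishesNear {P : Matrix (Fin (d + 1)) (Fin (d + 1)) ℂ} (hP : IsLorentzMat P)
    (hPdet : P.det = 1) : ¬ DetVanishesNear P := by
  intro hbad
  obtain ⟨Γ, hΓc, hΓ0, hΓ1, hΓ⟩ := exists_path_properLorentz hP hPdet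
  -- reversed path from `P` to `1`
  set Γ' : ℝ → Matrix (Fin (d + 1)) (Fin (d + 1)) ℂ := fun t => Γ (1 - t) with hΓ'
  have hΓ'c : ContinuousOn Γ' (Icc 0 1) := by
    refine hΓc.comp (continuous_const.sub continuous_id).continuousOn fun t ht => ?_
    exact ⟨by linarith [ht.2], by linarith [ht.1]⟩
  have hΓ'mem : ∀ t ∈ Icc (0 : ℝ) 1, IsLorentzMat (Γ' t) ∧ (Γ' t).det = 1 := fun t ht =>
    hΓ (1 - t) ⟨by linarith [ht.2], by linarith [ht.1]⟩
  set S : Set ℝ := {t | DetVanishesNear (Γ' t)} with hS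
  have h0 : (0 : ℝ) ∈ S := by show DetVanishesNear (Γ (1 - 0)); rw [sub_zero, hΓ1]; exact hbad
  have key : Icc (0 : ℝ) 1 ⊆ S := by
    refine IsClosed.Icc_subset_of_forall_mem_nhdsWithin ?_ h0 ?_
    · rw [isClosed_iff_frequently]
      intro t ht
      have htI : t ∈ Icc (0 : ℝ) 1 :=
        (isClosed_iff_frequently.1 isClosed_Icc) t (ht.mono fun s hs => hs.2)
      refine ⟨?_, htI⟩
      show DetVanishesNear (Γ' t)
      refine detVanishesNear_of_frequently (hΓ'mem t htI).1 (hΓ'mem t htI).2 ?_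
      have hcont : Tendsto Γ' (𝓝[Icc 0 1] t) (𝓝 (Γ' t)) := (hΓ'c t htI).tendsto
      have hfr : ∃ᶠ s in 𝓝[Icc 0 1] t, (IsLorentzMat (Γ' s) ∧ (Γ' s).det = 1) ∧
          DetVanishesNear (Γ' s) := by
        rw [frequently_nhdsWithin_iff]
        exact ht.mono fun s hs => ⟨⟨hΓ'mem s hs.2, hs.1⟩, hs.2⟩
      exact hcont.frequently hfr
    · rintro t ⟨htS, htI⟩
      have htI' : t ∈ Icc (0 : ℝ) 1 := Ico_subset_Icc_self htI
      have hev : ∀ᶠ Q in 𝓝 (Γ' t), DetVanishesNear Q := (htS : DetVanishesNear (Γ' t)).eventually_nhds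
      have h2 : ∀ᶠ s in 𝓝[Icc 0 1] t, DetVanishesNear (Γ' s) := (hΓ'c t htI').tendsto.eventually hev
      rw [eventually_nhdsWithin_iff] at h2
      have h3 : ∀ᶠ s in 𝓝[>] t, s ∈ Icc (0 : ℝ) 1 := by
        filter_upwards [Ioo_mem_nhdsGT htI.2] with s hs using ⟨htI.1.trans hs.1.le, hs.2.le⟩
      filter_upwards [h3, h2.filter_mono nhdsWithin_le_nhds] with s hs h using h hs
  have h1' : DetVanishesNear (1 : Matrix (Fin (d + 1)) (Fin (d + 1)) ℂ) := by
    have h1 : DetVanishesNear (Γ (1 - 1)) := key ⟨zero_le_one, le_rfl⟩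
    rwa [sub_self, hΓ0] at h1
  have := (h1'.self_of_nhds : IsLorentzMat (1 : Matrix (Fin (d + 1)) (Fin (d + 1)) ℂ) →
    (1 : Matrix (Fin (d + 1)) (Fin (d + 1)) ℂ).det = 1 →
      (1 + (1 : Matrix (Fin (d + 1)) (Fin (d + 1)) ℂ)).det = 0) IsLorentzMat.one det_one
  rw [show (1 : Matrix (Fin (d + 1)) (Fin (d + 1)) ℂ) + 1 = (2 : ℂ) • 1 by rw [two_smul],
    Matrix.det_smul, Matrix.det_one, mul_one] at this
  exact pow_ne_zero _ (two_ne_zero (α := ℂ)) this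

/-- Density, pointwise form: near every proper Lorentz matrix there are proper Lorentz matrices
`M` with `det (1 + M) ≠ 0`. [folklore] -/
theorem frequently_det_one_add_ne_zero {P : Matrix (Fin (d + 1)) (Fin (d + 1)) ℂ} (hP : IsLorentzMat P)
    (hPdet : P.det = 1) :
    ∃ᶠ M in 𝓝 P, (IsLorentzMat M ∧ M.det = 1) ∧ (1 + M).det ≠ 0 := by
  have h := not_detVanishesNear hP hPdet
  rw [DetVanishesNear, Filter.not_eventually] at h
  refine h.mono fun M hM => ?_
  push Not at hM
  exact ⟨⟨hM.1, hM.2.1⟩, hM.2.2⟩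

end Density

/-! ### The Cayley segment: proper Lorentz matrices in `N₁` with `1 + Λ` invertible are joined to `1` -/

section CayleyStar

open Filter Set Metric Complex
open _root_.Topology
open scoped Matrix.Norms.Operator

variable {d : ℕ}

/-- The polynomial `t ↦ det (1 + tX)`. [folklore] -/
def detPoly (X : Matrix (Fin (d + 1)) (Fin (d + 1)) ℂ) : Polynomial ℂ :=
  Matrix.det ((1 : Matrix (Fin (d + 1)) (Fin (d + 1)) (Polynomial ℂ)) +
    (Polynomial.X : Polynomial ℂ) • X.map Polynomial.C)

/-- `detPoly X` evaluates to `det (1 + tX)`. [folklore] -/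
theorem eval_detPoly (X : Matrix (Fin (d + 1)) (Fin (d + 1)) ℂ) (t : ℂ) :
    (detPoly X).eval t = (1 + t • X).det := by
  unfold detPoly
  rw [← Polynomial.coe_evalRingHom, RingHom.map_det]
  congr 1
  ext i j
  rw [RingHom.mapMatrix_apply, Matrix.map_apply, Matrix.add_apply, Matrix.add_apply, Matrix.smul_apply,
    Matrix.smul_apply, Matrix.map_apply, Polynomial.coe_evalRingHom, Polynomial.eval_add, smul_eq_mul,
    Polynomial.eval_mul, Polynomial.eval_X, Polynomial.eval_C, smul_eq_mul, Matrix.one_apply,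
    Matrix.one_apply]
  split_ifs <;> simp

/-- `detPoly X ≠ 0` (its value at `0` is `1`). [folklore] -/
theorem detPoly_ne_zero (X : Matrix (Fin (d + 1)) (Fin (d + 1)) ℂ) : detPoly X ≠ 0 := by
  intro h
  have := eval_detPoly X 0
  rw [h, Polynomial.eval_zero, zero_smul, add_zero, Matrix.det_one] at this
  exact zero_ne_one this

/-- Real part of the arc. [folklore] -/
theorem arc_re (ε s : ℝ) : (Orth.arc ε s).re = s := by simp [Orth.arc]

/-- Imaginary part of the arc. [folklore] -/
theorem arc_im (ε s : ℝ) : (Orth.arc ε s).im = ε * s * (1 - s) := by simp [Orth.arc]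

/-- `Im (t z) = Re t · Im z + Im t · Re z` for vectors. [folklore] -/
theorem imPart_complex_smul (t : ℂ) (z : Fin (d + 1) → ℂ) :
    imPart (t • z) = t.re • imPart z + t.im • rePart z := by
  ext μ
  simp [imPart, rePart, Complex.mul_im]

/-- **Stability inside the forward cone**: if `y + v, y − v ∈ V₊` then `y ± σv + w ∈ V₊` for all
`σ ∈ [0, 1]` and all small `w` (openness and convexity of `V₊`). [folklore] -/
theorem exists_delta_forwardCone {y v : SpaceTime d} (hyv : y + v ∈ forwardCone d)
    (hyv' : y - v ∈ forwardCone d) :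
    ∃ δ > 0, ∀ σ ∈ Icc (0 : ℝ) 1, ∀ w : SpaceTime d, ‖w‖ < δ →
      y + σ • v + w ∈ forwardCone d ∧ y - σ • v + w ∈ forwardCone d := by
  have hconv := QuantumFieldTheory.convex_forwardCone (d := d)
  have hy : y ∈ forwardCone d := by
    have := hconv hyv hyv' (by norm_num : (0 : ℝ) ≤ 1 / 2) (by norm_num : (0 : ℝ) ≤ 1 / 2)
      (by norm_num)
    convert this using 1
    module
  obtain ⟨δ₁, hδ₁, h₁⟩ := Metric.isOpen_iff.1 isOpen_forwardCone _ hyv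
  obtain ⟨δ₂, hδ₂, h₂⟩ := Metric.isOpen_iff.1 isOpen_forwardCone _ hyv'
  obtain ⟨δ₃, hδ₃, h₃⟩ := Metric.isOpen_iff.1 isOpen_forwardCone _ hy
  refine ⟨min δ₁ (min δ₂ δ₃), lt_min hδ₁ (lt_min hδ₂ hδ₃), fun σ hσ w hw => ?_⟩
  have hw₁ : y + v + w ∈ forwardCone d := h₁ (by
    rw [mem_ball, dist_eq_norm, add_sub_cancel_left]; exact hw.trans_le (min_le_left _ _))
  have hw₂ : y - v + w ∈ forwardCone d := h₂ (by
    rw [mem_ball, dist_eq_norm, add_sub_cancel_left]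
    exact hw.trans_le ((min_le_right _ _).trans (min_le_left _ _)))
  have hw₃ : y + w ∈ forwardCone d := h₃ (by
    rw [mem_ball, dist_eq_norm, add_sub_cancel_left]
    exact hw.trans_le ((min_le_right _ _).trans (min_le_right _ _)))
  constructor
  · have := hconv hw₁ hw₃ hσ.1 (sub_nonneg.2 hσ.2) (by ring)
    convert this using 1
    module
  · have := hconv hw₂ hw₃ hσ.1 (sub_nonneg.2 hσ.2) (by ring)
    convert this using 1
    module

/-- **The Cayley segment inside `N₁`** (with a small detour through complex parameters): a proper
Lorentz matrix `Λ = C(X) ∈ N₁` with `1 + Λ` invertible is joined to `1` inside `N₁` by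
`s ↦ C(τ(s)X)`, `τ(s) = s + iεs(1−s)`: the same vector `ξ` witnesses the tube condition for all
these matrices (the condition on `X` is star shaped in the diamond `(y − V₊) ∩ (V₊ − y)`), and the
arc avoids the finitely many `t` with `det (1 + tX) = 0`. [folklore] -/
theorem joinedIn_oneTubeMeetSet_of_det_ne_zero {Λ : Matrix (Fin (d + 1)) (Fin (d + 1)) ℂ}
    (hΛ : IsLorentzMat Λ) (h1 : (1 + Λ).det ≠ 0) {ζ : Fin (d + 1) → ℂ}
    (hζ : imPart ζ ∈ forwardCone d) (hΛζ : imPart (Λ *ᵥ ζ) ∈ forwardCone d) :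
    JoinedIn (oneTubeMeetSet d) 1 Λ := by
  have hu : IsUnit (1 + Λ).det := isUnit_iff_ne_zero.2 h1
  set X := cayley Λ with hX
  have hXskew : IsSkewMat X := hΛ.isSkewMat_cayley hu
  have h1X : IsUnit (1 + X).det := isUnit_det_one_add_cayley hu
  obtain ⟨ξ, hξ⟩ : ∃ ξ : Fin (d + 1) → ℂ, ξ = (1 / 2 : ℂ) • ((1 + Λ) *ᵥ ζ) := ⟨_, rfl⟩
  have hplus : (1 + X) *ᵥ ξ = ζ := by
    rw [hX, one_add_cayley hu, hξ, Matrix.mulVec_smul, Matrix.smul_mulVec, smul_smul,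
      Matrix.mulVec_mulVec, Matrix.nonsing_inv_mul _ hu, Matrix.one_mulVec]
    norm_num
  have hminus : (1 - X) *ᵥ ξ = Λ *ᵥ ζ := by
    rw [← cayley_mul_one_add h1X, ← Matrix.mulVec_mulVec, hplus, hX, cayley_cayley hu]
  -- the data `y = Im ξ`, `v = Im Xξ`, `r = Re Xξ`
  obtain ⟨y, hy⟩ : ∃ y : SpaceTime d, y = imPart ξ := ⟨_, rfl⟩
  obtain ⟨v, hv⟩ : ∃ v : SpaceTime d, v = imPart (X *ᵥ ξ) := ⟨_, rfl⟩
  obtain ⟨r, hr⟩ : ∃ r : SpaceTime d, r = rePart (X *ᵥ ξ) := ⟨_, rfl⟩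
  have him : ∀ t : ℂ, imPart ((1 + t • X) *ᵥ ξ) = y + t.re • v + t.im • r ∧
      imPart ((1 - t • X) *ᵥ ξ) = y - t.re • v - t.im • r := by
    intro t
    rw [hy, hv, hr]
    constructor
    · rw [Matrix.add_mulVec, Matrix.one_mulVec, Matrix.smul_mulVec, imPart_add, imPart_complex_smul]
      abel
    · rw [Matrix.sub_mulVec, Matrix.one_mulVec, Matrix.smul_mulVec, imPart_sub, imPart_complex_smul]
      abel
  have hyv : y + v ∈ forwardCone d := by
    have := (him 1).1
    rw [one_smul, hplus, Complex.one_re, Complex.one_im, one_smul, zero_smul, add_zero] at this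
    rw [← this]; exact hζ
  have hyv' : y - v ∈ forwardCone d := by
    have := (him 1).2
    rw [one_smul, hminus, Complex.one_re, Complex.one_im, one_smul, zero_smul, sub_zero] at this
    rw [← this]; exact hΛζ
  obtain ⟨δ, hδ, hseg⟩ := exists_delta_forwardCone hyv hyv'
  -- the arc parameter
  set ε₀ : ℝ := δ / (‖r‖ + 1) with hε₀
  have hε₀pos : 0 < ε₀ := div_pos hδ (by positivity)
  set F : Finset ℂ := (detPoly X).roots.toFinset with hF
  have hmemF : ∀ t, t ∈ F ↔ (1 + t • X).det = 0 := by
    intro t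
    rw [hF, Multiset.mem_toFinset, Polynomial.mem_roots (detPoly_ne_zero X), Polynomial.IsRoot.def,
      eval_detPoly]
  have h0F : (0 : ℂ) ∉ F := by rw [hmemF]; simp
  have h1F : (1 : ℂ) ∉ F := by rw [hmemF, one_smul]; exact isUnit_iff_ne_zero.1 h1X
  obtain ⟨ε, ⟨hε0, hεε₀⟩, hεF⟩ := Orth.exists_arc_avoid F h0F h1F (Set.Ioo_infinite hε₀pos)
  have hεr : ε * ‖r‖ < δ := by
    have : ε * (‖r‖ + 1) < δ := by rwa [hε₀, lt_div_iff₀ (by positivity)] at hεε₀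
    nlinarith [norm_nonneg r]
  -- the path and its properties
  set γ : ℝ → Matrix (Fin (d + 1)) (Fin (d + 1)) ℂ := fun s => cayley (Orth.arc ε s • X) with hγ
  have hdetne : ∀ s ∈ Icc (0 : ℝ) 1, IsUnit (1 + Orth.arc ε s • X).det := fun s hs =>
    isUnit_iff_ne_zero.2 fun h => hεF s hs ((hmemF _).2 h)
  have hmem : ∀ s ∈ Icc (0 : ℝ) 1, γ s ∈ oneTubeMeetSet d := by
    intro s hs
    have hsk : IsSkewMat (Orth.arc ε s • X) := hXskew.smul _
    refine ⟨⟨hsk.isLorentzMat_cayley (hdetne s hs), hsk.det_cayley (hdetne s hs)⟩,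
      (1 + Orth.arc ε s • X) *ᵥ ξ, ?_, ?_⟩
    · rw [(him _).1, arc_re, arc_im]
      have hw : ‖(ε * s * (1 - s)) • r‖ < δ := by
        rw [norm_smul, Real.norm_eq_abs]
        have hs01 : 0 ≤ s * (1 - s) ∧ s * (1 - s) ≤ 1 := by
          constructor <;> nlinarith [hs.1, hs.2]
        have : |ε * s * (1 - s)| ≤ ε := by
          rw [abs_of_nonneg (by nlinarith [hs01.1, hε0.le]), mul_assoc]
          nlinarith [hs01.2, hε0.le]
        calc |ε * s * (1 - s)| * ‖r‖ ≤ ε * ‖r‖ := mul_le_mul_of_nonneg_right this (norm_nonneg _)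
          _ < δ := hεr
      exact (hseg s hs _ hw).1
    · rw [hγ]
      simp only
      rw [Matrix.mulVec_mulVec, cayley_mul_one_add (hdetne s hs), (him _).2, arc_re, arc_im,
        sub_eq_add_neg (y - s • v), ← neg_smul]
      have hw : ‖(-(ε * s * (1 - s))) • r‖ < δ := by
        rw [norm_smul, norm_neg, Real.norm_eq_abs]
        have hs01 : 0 ≤ s * (1 - s) ∧ s * (1 - s) ≤ 1 := by
          constructor <;> nlinarith [hs.1, hs.2]
        have : |ε * s * (1 - s)| ≤ ε := by
          rw [abs_of_nonneg (by nlinarith [hs01.1, hε0.le]), mul_assoc]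
          nlinarith [hs01.2, hε0.le]
        calc |ε * s * (1 - s)| * ‖r‖ ≤ ε * ‖r‖ := mul_le_mul_of_nonneg_right this (norm_nonneg _)
          _ < δ := hεr
      exact (hseg s hs _ hw).2
  have hγc : ContinuousOn γ (Icc 0 1) := by
    intro s hs
    have hc : Continuous fun s : ℝ => Orth.arc ε s • X := (Orth.continuous_arc ε).smul continuous_const
    exact (ContinuousAt.comp (f := fun s : ℝ => Orth.arc ε s • X) (x := s)
      (continuousAt_cayley (hdetne s hs)) hc.continuousAt).continuousWithinAt
  refine JoinedIn.ofLine hγc ?_ ?_ ?_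
  · show cayley (Orth.arc ε 0 • X) = 1
    rw [Orth.arc_zero, zero_smul, cayley_zero]
  · show cayley (Orth.arc ε 1 • X) = Λ
    rw [Orth.arc_one, one_smul, hX, cayley_cayley hu]
  · rintro _ ⟨s, hs, rfl⟩
    exact hmem s hs

end CayleyStar

/-! ### `N₁` is path connected: discharge of `oneTubeMeetSet_isConnected` -/

section Discharge

open Filter Set Metric Complex
open _root_.Topology
open scoped Matrix.Norms.Operator

variable {d : ℕ}

/-- The tube-meeting condition on matrices is open. [folklore] -/
theorem isOpen_setOf_exists_tube_vector :
    IsOpen {M : Matrix (Fin (d + 1)) (Fin (d + 1)) ℂ |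
      ∃ ζ : Fin (d + 1) → ℂ, imPart ζ ∈ forwardCone d ∧ imPart (M *ᵥ ζ) ∈ forwardCone d} := by
  have : {M : Matrix (Fin (d + 1)) (Fin (d + 1)) ℂ |
      ∃ ζ : Fin (d + 1) → ℂ, imPart ζ ∈ forwardCone d ∧ imPart (M *ᵥ ζ) ∈ forwardCone d} =
      ⋃ ζ ∈ {ζ : Fin (d + 1) → ℂ | imPart ζ ∈ forwardCone d},
        {M | imPart (M *ᵥ ζ) ∈ forwardCone d} := by
    ext M
    simp only [mem_setOf_eq, mem_iUnion, exists_prop]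
  rw [this]
  refine isOpen_biUnion fun ζ _ => ?_
  exact isOpen_forwardCone.preimage (continuous_imPart.comp (mulVecCLM ζ).continuous)

/-- **Every matrix of `N₁` is joined to `1` inside `N₁`.** If `1 + Λ` is invertible this is the Cayley
segment; otherwise move first, inside the (open) set `N₁`, along a chart segment to a nearby proper
Lorentz matrix `M` with `1 + M` invertible (`frequently_det_one_add_ne_zero`). [folklore] -/
theorem joinedIn_oneTubeMeetSet_one {Λ : Matrix (Fin (d + 1)) (Fin (d + 1)) ℂ}
    (hΛN : Λ ∈ oneTubeMeetSet d) : JoinedIn (oneTubeMeetSet d) 1 Λ := by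
  obtain ⟨⟨hΛL, hΛdet⟩, ζ, hζ, hΛζ⟩ := hΛN
  by_cases h1 : (1 + Λ).det ≠ 0
  · exact joinedIn_oneTubeMeetSet_of_det_ne_zero hΛL h1 hζ hΛζ
  push Not at h1
  -- a chart ball at `Λ` inside `N₁`
  set D : Set (Matrix (Fin (d + 1)) (Fin (d + 1)) ℂ) := {B | IsUnit (1 + sk B).det ∧
    ∃ ζ : Fin (d + 1) → ℂ, imPart ζ ∈ forwardCone d ∧ imPart (chart Λ B *ᵥ ζ) ∈ forwardCone d} with hD
  have hDopen : IsOpen D := by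
    have hc : ContinuousOn (chart Λ) {B : Matrix (Fin (d + 1)) (Fin (d + 1)) ℂ | IsUnit (1 + sk B).det} :=
      fun B hB => (differentiableAt_chart Λ hB).continuousAt.continuousWithinAt
    exact hc.isOpen_inter_preimage isOpen_isUnit_sk isOpen_setOf_exists_tube_vector
  have h0D : (0 : Matrix (Fin (d + 1)) (Fin (d + 1)) ℂ) ∈ D :=
    ⟨by simp, ζ, hζ, by rw [chart_zero]; exact hΛζ⟩
  obtain ⟨r, hr, hball⟩ := Metric.isOpen_iff.1 hDopen 0 h0D
  have hDN : ∀ B ∈ D, chart Λ B ∈ oneTubeMeetSet d := fun B hB =>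
    ⟨chart_mem_properLorentzMatSet (P := Λ) ⟨hΛL, hΛdet⟩ hB.1, hB.2⟩
  -- a good matrix in the ball
  have hev : ∀ᶠ M in 𝓝 Λ, unchart Λ M ∈ ball (0 : Matrix (Fin (d + 1)) (Fin (d + 1)) ℂ) r ∧
      IsUnit (1 + M * minkInv Λ).det :=
    ((tendsto_unchart hΛL).eventually (isOpen_ball.mem_nhds (mem_ball_self hr))).and
      (eventually_isUnit_one_add hΛL)
  obtain ⟨M, ⟨⟨hML, -⟩, hM1⟩, hMball, hMu⟩ :=
    ((frequently_det_one_add_ne_zero hΛL hΛdet).and_eventually hev).exists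
  set B₁ := unchart Λ M with hB₁
  have hchart₁ : chart Λ B₁ = M := chart_unchart hΛL hML hMu
  have hMN : M ∈ oneTubeMeetSet d := by rw [← hchart₁]; exact hDN B₁ (hball hMball)
  -- the chart segment from `Λ` to `M`
  have hsegball : ∀ s ∈ Icc (0 : ℝ) 1, (s • B₁ : Matrix (Fin (d + 1)) (Fin (d + 1)) ℂ) ∈ ball 0 r := by
    intro s hs
    rw [mem_ball, dist_zero_right, norm_smul, Real.norm_eq_abs, abs_of_nonneg hs.1]
    rw [mem_ball, dist_zero_right] at hMball
    calc s * ‖B₁‖ ≤ 1 * ‖B₁‖ := mul_le_mul_of_nonneg_right hs.2 (norm_nonneg _)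
      _ < r := by rw [one_mul]; exact hMball
  have hΛM : JoinedIn (oneTubeMeetSet d) Λ M := by
    refine JoinedIn.ofLine (f := fun s : ℝ => chart Λ (s • B₁)) ?_ ?_ ?_ ?_
    · intro s hs
      have hc : Continuous fun s : ℝ => (s • B₁ : Matrix (Fin (d + 1)) (Fin (d + 1)) ℂ) :=
        continuous_id.smul continuous_const
      exact (ContinuousAt.comp (f := fun s : ℝ => (s • B₁ : Matrix (Fin (d + 1)) (Fin (d + 1)) ℂ))
        (x := s) (differentiableAt_chart Λ (hball (hsegball s hs)).1).continuousAt
        hc.continuousAt).continuousWithinAt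
    · show chart Λ ((0 : ℝ) • B₁) = Λ
      rw [zero_smul, chart_zero]
    · show chart Λ ((1 : ℝ) • B₁) = M
      rw [one_smul, hchart₁]
    · rintro _ ⟨s, hs, rfl⟩
      exact hDN _ (hball (hsegball s hs))
  obtain ⟨⟨-, -⟩, ζ', hζ', hMζ'⟩ := hMN
  exact (joinedIn_oneTubeMeetSet_of_det_ne_zero hML hM1 hζ' hMζ').trans hΛM.symm

/-- `i e₀` lies in the one-particle tube. [folklore] -/
theorem imPart_I_single_mem_forwardCone :
    imPart (fun μ : Fin (d + 1) => if μ = 0 then Complex.I else 0) ∈ forwardCone d := by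
  rw [mem_forwardCone_iff]
  constructor
  · simp [imPart]
  · simp [minkowskiForm_apply, imPart, Fin.succ_ne_zero]

/-- **Discharge of the named fact `oneTubeMeetSet_isConnected`: the set
`{g ∈ L₊(ℂ) | gI₁ ∩ I₁ ≠ ∅}` is (path) connected, in every dimension.** [folklore] -/
theorem _root_.Literature.MathematicalPhysics.QuantumLattice.oneTubeMeetSet_isConnected_holds (d : ℕ) :
    oneTubeMeetSet_isConnected d := by
  refine IsPathConnected.isConnected (isPathConnected_iff.2 ⟨⟨1, ?_⟩, fun x hx y hy => ?_⟩)
  · refine ⟨⟨IsLorentzMat.one, Matrix.det_one⟩, _, imPart_I_single_mem_forwardCone, ?_⟩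
    rw [Matrix.one_mulVec]; exact imPart_I_single_mem_forwardCone
  · exact (joinedIn_oneTubeMeetSet_one hx).symm.trans (joinedIn_oneTubeMeetSet_one hy)

end Discharge

end BHW

/-! ### The Bargmann–Hall–Wightman theorem, unconditionally -/

section Holds

variable {d n : ℕ} {κ : Type*}

/-- **Discharge of the named fact `exists_extension_extendedForwardTube` (the Bargmann–Hall–Wightman
theorem, Streater–Wightman Thm. 2-11, invariant case), in every space dimension `d` and every number
of points `n`.** [cite: StreaterWightman2001, Thm 2-11 (pdf pp. 58–61)] -/
theorem exists_extension_extendedForwardTube_holds :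
    exists_extension_extendedForwardTube (d := d) (n := n) :=
  exists_extension_extendedForwardTube_of_isConnected (oneTubeMeetSet_isConnected_holds d)

/-- **`IsWightmanQFT.exists_invariant_continuation` from the spectral condition and the
Fourier–Laplace representation alone** (the Bargmann–Hall–Wightman input being now a theorem).
[cite: StreaterWightman2001, Thm 3-5 with Thm 2-11 (pdf pp. 100–101)] -/
theorem IsWightmanQFT.exists_invariant_continuation_of_spectral_of_laplace
    (hb : ∀ W : WightmanData d κ, IsWightmanQFT.hasSpectralCondition_family (W := W))
    (hL : ∀ n : ℕ, Literature.Analysis.Distribution.fourierLaplace_coneSupport (Fin n × Fin (d + 1))) :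
    IsWightmanQFT.exists_invariant_continuation (d := d) (κ := κ) :=
  IsWightmanQFT.exists_invariant_continuation_of_three_facts hb hL (oneTubeMeetSet_isConnected_holds d)

end Holds

end Literature.MathematicalPhysics.QuantumLattice
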